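import Summits.QuantumFields.GaugeBoot.Rows.GLYZc2D3RedCheck1
import Summits.QuantumFields.GaugeBoot.Rows.GLYZc2D3RedCheck2
import Summits.QuantumFields.GaugeBoot.Rows.GLYZc2D3RedCheck3
import Summits.QuantumFields.GaugeBoot.Rows.GLYZc2D3RedCheck4
import Summits.QuantumFields.GaugeBoot.Rows.GLYZc2D3RedCheck5
import Summits.QuantumFields.GaugeBoot.Rows.GLYZc2D3Canon
import HarnessLib

/-!
# Gauge-boot: THE REDUCTION STEP — the 18 reduced positivity blocks of the glyz-c2-rp-3D problems are PSD for the torus state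

Cell `pub-gaugeboot` (HOME `run/shared/lean/pub/pub-gaugeboot/`), seat lean1 (binding layer for rows C32–C33, C51–C60 = the certified
glyz-c2-rp-3D windows: label sets, class/witness tables, the reduction identity, soundness, per-β bindings).

HONEST FRAMING (page 1 of every file of this cell): certified bounds on lattice expectations at STATED coupling,
gauge group, dimension and torus size; NOT a mass gap, NOT a continuum limit, NOT a string tension, NOT large `N`.
The venture is explicitly NOT Yang–Mills-summit-bearing (barriers `FixedCouplingUltralocality`,
`PerturbativeInvisibility`).

`redBlock k (y β L)` (`GLYZc2D3Ent`: block `k` of the problem files, entries `Σ c·y_v`, evaluated on the torus expectations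
`y β L v = ⟨W_0(label v)⟩`) is positive semidefinite for every `k < 18`, every real `β ≥ 0` (`β ≥ 0` is used only by the
link blocks; `H` blocks need nothing, site blocks only `L` even), every even torus `(ℤ/L)^3` with `L ≥ 4`:
`redBlock_posSemidef`. Proof = the kernel-checked identities `GLYZc2D3RedCheck1…` (file entries = `Y_kᵀ·cls·Y_k` as sparse
integer forms) + the evaluation lemmas below (`SVec.eval_expand`, `SVec.eval_eq_sum_fin`) giving
`redBlock k y = Y_kᴴ · rawBlock · Y_k` as real matrices + Mathlib's congruence `Matrix.PosSemidef.conjTranspose_mul_mul_same`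
applied to the raw class-table blocks `rawBlockH/S/L_posSemidef` (`GLYZc2D3Canon`: Gram / site-RP / link-RP from the tree's
`WordLoop` / `WordSiteRP` / `WordLinkRP`). With lean2's equality rows and lean3's certificate halves over `redBlock` this
closes rows C32–C33, C51–C60 end to end (per-β `GLYZc2D3BindB<β>`).
-/

noncomputable section

open Literature.MathematicalPhysics.QuantumFieldTheory
open Matrix

namespace Summit.QuantumFields.GaugeBoot

namespace GLYZc2D3

namespace SVec

/-- `eval` of a scaled, relabelled copy (this family's copy of the sparse-form kit lemma). -/
theorem eval_map_scale (f : ℕ → ℕ) (c : ℤ) (g : ℕ → ℝ) (l : SVec) :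
    eval g (l.map fun q => (f q.1, c * q.2)) = (c : ℝ) * eval (fun b => g (f b)) l := by
  induction l with
  | nil => simp
  | cons q t ih => simp only [List.map_cons, eval_cons, ih]; push_cast; ring

/-- **`eval` of an expansion is the iterated evaluation** (this family's copy). -/
theorem eval_expand (cls : ℕ → ℕ → ℕ) (cj : SVec) (g : ℕ → ℝ) (ci : SVec) :
    eval g (expand ci cj cls) = eval (fun a => eval (fun b => g (cls a b)) cj) ci := by
  induction ci with
  | nil => simp [expand]
  | cons p t ih =>
    simp only [expand, List.flatMap_cons] at ih ⊢
    rw [eval_append, ih, eval_map_scale, eval_cons]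

/-- **A sparse form with keys `< n` evaluates as a finite sum over `Fin n` against its coefficients** (this family's copy). -/
theorem eval_eq_sum_fin {n : ℕ} (l : SVec) (g : ℕ → ℝ) (hl : ∀ p ∈ l, p.1 < n) :
    eval g l = ∑ a : Fin n, (coeff l a.val : ℝ) * g a.val := by
  induction l with
  | nil => simp [coeff]
  | cons p t ih =>
    obtain ⟨v, c⟩ := p
    have hv : v < n := hl (v, c) List.mem_cons_self
    have ih' := ih fun q hq => hl q (List.mem_cons_of_mem _ hq)
    have hsplit : ∀ a : Fin n, (coeff ((v, c) :: t) a.val : ℝ) * g a.val =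
        (if a = ⟨v, hv⟩ then (c : ℝ) * g v else 0) + (coeff t a.val : ℝ) * g a.val := by
      intro a
      by_cases ha : a = ⟨v, hv⟩
      · subst ha; simp [coeff, add_mul]
      · have hva : v ≠ a.val := fun h' => ha (Fin.ext h'.symm)
        simp [coeff, hva, ha]
    rw [Finset.sum_congr rfl fun a _ => hsplit a, Finset.sum_add_distrib, Finset.sum_ite_eq' Finset.univ, ← ih']
    simp

end SVec

variable (β : ℝ) (L : ℕ) [NeZero L]

/-- **Congruence step (generic in the block)**: if the sparse columns `cols` have raw indices `< n`, the normalised expansion of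
`colsᵢᵀ·cls·colsⱼ` equals the entry table `entf` entry by entry, and the raw class-table matrix `(y (cls a b))_{a,b<n}` is PSD,
then the `m × m` matrix of entry values `(eval y (entf i j))_{i,j}` is PSD — it is `Yᴴ · raw · Y`. -/
theorem entryMatrix_posSemidef {n m : ℕ} (y : Fin 1449 → ℝ) (cls : ℕ → ℕ → Fin 1449) (cols : ℕ → SVec)
    (entf : ℕ → ℕ → SVec) (hcols : ∀ i < m, ∀ p ∈ cols i, p.1 < n)
    (hid : ∀ i j : Fin m, SVec.dropZero (SVec.normExpand (cols i) (cols j) fun a b => (cls a b).val) = entf i j)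
    (hraw : (Matrix.of fun a b : Fin n => y (cls a b)).PosSemidef) :
    (Matrix.of fun i j : Fin m => SVec.eval (yN y) (entf i.val j.val)).PosSemidef := by
  set Y : Matrix (Fin n) (Fin m) ℝ := Matrix.of fun a i => (SVec.coeff (cols i.val) a.val : ℝ) with hY
  have key : (Matrix.of fun i j : Fin m => SVec.eval (yN y) (entf i.val j.val)) =
      Yᴴ * (Matrix.of fun a b : Fin n => y (cls a b)) * Y := by
    ext i j
    have h1 : SVec.eval (yN y) (entf i.val j.val) =
        SVec.eval (yN y) (SVec.expand (cols i.val) (cols j.val) fun a b => (cls a b).val) := by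
      rw [← hid i j, SVec.eval_dropZero, SVec.eval_normExpand]
    rw [Matrix.of_apply, h1, SVec.eval_expand, SVec.eval_eq_sum_fin (cols i.val) _ (hcols i.val i.isLt)]
    simp only [SVec.eval_eq_sum_fin (cols j.val) _ (hcols j.val j.isLt), Matrix.mul_apply, Matrix.conjTranspose_apply,
      Matrix.of_apply, star_trivial, hY, Finset.mul_sum, Finset.sum_mul]
    rw [Finset.sum_comm]
    refine Finset.sum_congr rfl fun b _ => Finset.sum_congr rfl fun a _ => ?_
    rw [show ((cls a.val b.val).val : ℕ) = (cls a b).val from rfl, yN_val]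
    ring
  rw [key]
  exact hraw.conjTranspose_mul_mul_same Y

/-- **THE REDUCTION STEP**: for `SU(2)` lattice gauge theory on every even torus `(ℤ/L)^3` with `L ≥ 4` and every standard
coupling `β ≥ 0`, all 18 reduced positivity blocks of the certified glyz-c2-rp-3D problems, evaluated on the torus loop
expectations `y β L`, are positive semidefinite. -/
theorem redBlock_posSemidef (hβ : 0 ≤ β) (hL : Even L) (h4 : 4 ≤ L) : ∀ k : Fin 18, (GLYZc2D3.redBlock k (GLYZc2D3.y β L)).PosSemidef := by
  intro k
  fin_cases k
  exacts [entryMatrix_posSemidef (y β L) hcls (ycol 0) (ent 0) ycol_lt_0 red_ok_0 (rawBlockH_posSemidef β L),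
    entryMatrix_posSemidef (y β L) hcls (ycol 1) (ent 1) ycol_lt_1 red_ok_1 (rawBlockH_posSemidef β L),
    entryMatrix_posSemidef (y β L) hcls (ycol 2) (ent 2) ycol_lt_2 red_ok_2 (rawBlockH_posSemidef β L),
    entryMatrix_posSemidef (y β L) hcls (ycol 3) (ent 3) ycol_lt_3 red_ok_3 (rawBlockH_posSemidef β L),
    entryMatrix_posSemidef (y β L) hcls (ycol 4) (ent 4) ycol_lt_4 red_ok_4 (rawBlockH_posSemidef β L),
    entryMatrix_posSemidef (y β L) hcls (ycol 5) (ent 5) ycol_lt_5 red_ok_5 (rawBlockH_posSemidef β L),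
    entryMatrix_posSemidef (y β L) hcls (ycol 6) (ent 6) ycol_lt_6 red_ok_6 (rawBlockH_posSemidef β L),
    entryMatrix_posSemidef (y β L) hcls (ycol 7) (ent 7) ycol_lt_7 red_ok_7 (rawBlockH_posSemidef β L),
    entryMatrix_posSemidef (y β L) hcls (ycol 8) (ent 8) ycol_lt_8 red_ok_8 (rawBlockH_posSemidef β L),
    entryMatrix_posSemidef (y β L) hcls (ycol 9) (ent 9) ycol_lt_9 red_ok_9 (rawBlockH_posSemidef β L),
    entryMatrix_posSemidef (y β L) scls (ycol 10) (ent 10) ycol_lt_10 red_ok_10 (rawBlockS_posSemidef β L hL),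
    entryMatrix_posSemidef (y β L) scls (ycol 11) (ent 11) ycol_lt_11 red_ok_11 (rawBlockS_posSemidef β L hL),
    entryMatrix_posSemidef (y β L) scls (ycol 12) (ent 12) ycol_lt_12 red_ok_12 (rawBlockS_posSemidef β L hL),
    entryMatrix_posSemidef (y β L) scls (ycol 13) (ent 13) ycol_lt_13 red_ok_13 (rawBlockS_posSemidef β L hL),
    entryMatrix_posSemidef (y β L) lcls (ycol 14) (ent 14) ycol_lt_14 red_ok_14 (rawBlockL_posSemidef β L hL h4 hβ),
    entryMatrix_posSemidef (y β L) lcls (ycol 15) (ent 15) ycol_lt_15 red_ok_15 (rawBlockL_posSemidef β L hL h4 hβ),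
    entryMatrix_posSemidef (y β L) lcls (ycol 16) (ent 16) ycol_lt_16 red_ok_16 (rawBlockL_posSemidef β L hL h4 hβ),
    entryMatrix_posSemidef (y β L) lcls (ycol 17) (ent 17) ycol_lt_17 red_ok_17 (rawBlockL_posSemidef β L hL h4 hβ)]

end GLYZc2D3

end Summit.QuantumFields.GaugeBoot

end
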